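/-
Copyright (c) 2026 the pub-hodgecm-mathlib formalisation cell (harness21).  Prover seat hodgecm-mathlib-K2E3-p03 (g4), Track B «K2-LIT» ∕ h413
(`stmt-HodgeConjecture-24833`), line `K2_E3_EllipticInputs`, unit U12, §L leaf (LBGL-ge3) at `N = 3` (Richardson road, owner K2E3-p11 (g4)), deal (D60)
«(S-B♭)_Lie ∕ (F-J): the split-Cartan slice density of 𝔤𝔩₃(F)» (K2E3-p17 (g6)), brick D: THE `K × N`-ORBITAL FUNCTIONAL OF A DIAGONAL ELEMENT OF `𝔤𝔩_n(F)`
IS `Ad(GL_n(F))`-INVARIANT.  2026-09-04.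
-/
import Literature.NumberTheory.Automorphic.GLnUnipotentRadicalUnimodular   -- ★ `exists_quotientMeasure_torus_eq_smul_map` (Iwasawa form `μ_{G⧸A} = C•((k,n) ↦ knA)_*(κ⊗μN)`), `mem_standardLeviGL_id_iff`, `mul_comm_of_mem_standardLeviGL_id`, `GLn.isMulRightInvariant_of_isHaarMeasure_local`
import Literature.MeasureTheory.Group.InvariantQuotientExistence           -- ★ `exists_smulInvariantMeasure_integral_fiberIntegral_eq` (a non-zero invariant Radon measure on `G ⧸ A`, Deitmar–Echterhoff Thm. 1.5.3)
import HarnessLib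

/-!
# K2_E3 road (h413), §L leaf (LBGL-ge3) at `N = 3`, (D60) brick D — the `K × N` orbital functional of a diagonal element of `𝔤𝔩_n(F)` is `Ad`-invariant

Cell `pub/hodgecm-mathlib` (D-0151), Track B (21-frontier RULING «PUSH BOTH» 2026-09-03, director req624), seat K2E3-p03 (g4) (free E3 hand on
K2E3-p17 (g6)'s (S-B♭)_Lie census `K2/K2E3-p17/g6/CENSUS-SBflatLie-N3.K2E3-p17-g6.md` §3, brick D «HAND WANTED #3»; dealer K2E3-plan (g3); Richardson
road owner K2E3-p11 (g4)).  `--supports stmt-HodgeConjecture-24833 --as helper`; THEOREMS ONLY (no definition ∕ instance ∕ notation ∕ named fact ∕ `sorry`);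
never imports `Cruxes/…/Lines`.  COUNT-NEUTRAL: (LBGL-ge3) `sig_K2E3GLnNilpotentFourierRegularGeThree` of U12 stays OPEN; this is step (ii)-invariance of
the census road towards the head H `K2E3GL3SplitCartanSliceDensity.exists_splitCartanSliceDensity`.

THE RESULT.  `F` a non-archimedean local field, `G = GL_n(F)`, `K = GL_n(𝒪)` (`glInt n F`) with a Haar measure `κ`, `N` the upper unitriangular group
(`unipotentRadicalGL F id`) with a Haar measure `μN`, `A` the diagonal torus (`standardLeviGL F id`).  For a matrix `X ∈ 𝔤𝔩_n(F)` with zero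
off-diagonal entries (e.g. `X = Matrix.diagonal d`, ANY `d` — regular or not) put
  `Ō_X(h) := ∫⁻_{K × N} h((k n) X (k n)⁻¹) d(κ ⊗ μN)`   (`h : 𝔤𝔩_n(F) → [0, ∞]` Borel).
Then **`Ō_X(h ∘ Ad g) = Ō_X(h)` for every `g ∈ GL_n(F)`** (`GLn.lintegral_prod_conj_eq_of_offDiag_eq_zero`, `GLn.lintegral_prod_conj_diagonal_eq`; the
`N = 3` head `GL3.lintegral_prod_conj_diagonal_eq` is the shape consumed by K2E3-p17 (g6)'s brick H).
PROOF.  `A` is closed and commutative, `G` is unimodular (★ `GLn.isMulRightInvariant_of_isHaarMeasure_local`), so `G ⧸ A` carries a non-zero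
`G`-invariant Radon measure `μ` (★ `exists_smulInvariantMeasure_integral_fiberIntegral_eq`, Deitmar–Echterhoff Thm. 1.5.3); by Gelbart's Iwasawa form
(★ `exists_quotientMeasure_torus_eq_smul_map`) `μ = C • ((k, n) ↦ k n A)_*(κ ⊗ μN)` with `C ≠ 0`.  The orbit map `Φ : y A ↦ y X y⁻¹` is well defined
(`A` centralises `X`) and continuous, so `Ō_X(h) = C⁻¹ ∫⁻_{G⧸A} h ∘ Φ dμ` and `Ō_X(h ∘ Ad g) = C⁻¹ ∫⁻_{G⧸A} (h ∘ Φ)(g • y) dμ(y)`, which agree by the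
`G`-invariance of `μ`.  [HarishChandra1970, Part V §2 p. 49 (the invariant integral on `G∕A`); Rogawski1990, §4.13 p. 69; Gelbart1975, Thm. 9.22 (iii)]
HONEST LABEL: HC_CM is proved only modulo the 7 printed citations (2 remaining named inputs: hLiu418 = stmt-HodgeConjecture-24832, h413 =
stmt-HodgeConjecture-24833) until rung 0 closes; count-neutral helper.

## References
* [HarishChandra1970] Harish-Chandra (notes by G. van Dijk), *Harmonic Analysis on Reductive p-adic Groups*, LNM 162 (1970), Part V §2.
* [Rogawski1990] J. D. Rogawski, *Automorphic Representations of Unitary Groups in Three Variables* (1990), §4.13, Lemma 4.13.1, pp. 69–70.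
* [Gelbart1975] S. Gelbart, *Automorphic forms on adele groups* (1975), Thm. 9.22 (iii), Remark 9.23.
* [DeitmarEchterhoff2014] A. Deitmar, S. Echterhoff, *Principles of Harmonic Analysis*, 2nd ed. (2014), Thm. 1.5.3.
-/

set_option autoImplicit false
set_option linter.dupNamespace false   -- `Summit.HodgeConjecture.HodgeConjecture.…` (D-0017 nested layout; lakefile exemption for Summits)

noncomputable section

open MeasureTheory Measure Filter Topology Set
open scoped MatrixGroups NNReal ENNReal Pointwise
open Literature.MeasureTheory.Group
open Literature.NumberTheory.Automorphic
open Literature.NumberTheory.GaloisRepresentations Literature.NumberTheory.GaloisRepresentations.IsNonarchimedeanLocalField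

namespace Summit.HodgeConjecture.HodgeConjecture.Cruxes.H413.K2E3GL3KNOrbitalAdInvariant

/-! ## §1  Algebra: the diagonal torus centralises every matrix with zero off-diagonal entries -/

section Algebra

variable {R : Type*} [CommRing R] {m : Type*} [Fintype m] [DecidableEq m] [LinearOrder m]

omit [LinearOrder m] in
/-- Two matrices with zero off-diagonal entries commute. [folklore] -/
theorem mul_comm_of_offDiag_eq_zero {a X : Matrix m m R} (ha : ∀ i j, i ≠ j → a i j = 0) (hX : ∀ i j, i ≠ j → X i j = 0) :
    a * X = X * a := by
  have ha' : Matrix.diagonal (fun i => a i i) = a := by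
    ext i j
    by_cases hij : i = j
    · subst hij; rw [Matrix.diagonal_apply_eq]
    · rw [Matrix.diagonal_apply_ne _ hij, ha i j hij]
  have hX' : Matrix.diagonal (fun i => X i i) = X := by
    ext i j
    by_cases hij : i = j
    · subst hij; rw [Matrix.diagonal_apply_eq]
    · rw [Matrix.diagonal_apply_ne _ hij, hX i j hij]
  rw [← ha', ← hX', Matrix.diagonal_mul_diagonal, Matrix.diagonal_mul_diagonal]
  congr 1
  funext i
  exact mul_comm _ _

/-- An element of the diagonal torus `A = M_{id}` of `GL_m(R)` commutes (as a matrix) with every matrix with zero off-diagonal entries.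
[cite: BernsteinZelevinsky1977, §2.1] -/
theorem coe_mul_eq_mul_coe_of_mem_standardLeviGL_id {a : GL m R} (ha : a ∈ standardLeviGL R (id : m → m)) {X : Matrix m m R}
    (hX : ∀ i j, i ≠ j → X i j = 0) : (a : Matrix m m R) * X = X * (a : Matrix m m R) :=
  mul_comm_of_offDiag_eq_zero ((mem_standardLeviGL_id_iff a).1 ha) hX

/-- **The orbit map is constant on `A`-cosets**: if `a⁻¹ b ∈ A` then `a X a⁻¹ = b X b⁻¹` for `X` with zero off-diagonal entries. [folklore] -/
theorem conj_eq_conj_of_inv_mul_mem_standardLeviGL_id {a b : GL m R} (hab : a⁻¹ * b ∈ standardLeviGL R (id : m → m)) {X : Matrix m m R}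
    (hX : ∀ i j, i ≠ j → X i j = 0) :
    (a : Matrix m m R) * X * ((a⁻¹ : GL m R) : Matrix m m R) = (b : Matrix m m R) * X * ((b⁻¹ : GL m R) : Matrix m m R) := by
  obtain ⟨c, rfl⟩ : ∃ c : GL m R, a * c = b := ⟨a⁻¹ * b, mul_inv_cancel_left a b⟩
  rw [inv_mul_cancel_left] at hab
  have hc := coe_mul_eq_mul_coe_of_mem_standardLeviGL_id hab hX
  rw [mul_inv_rev, Units.val_mul, Units.val_mul, Matrix.mul_assoc (a : Matrix m m R) (c : Matrix m m R) X, hc,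
    ← Matrix.mul_assoc (a : Matrix m m R) X (c : Matrix m m R), Matrix.mul_assoc _ (c : Matrix m m R),
    ← Matrix.mul_assoc (c : Matrix m m R), Units.mul_inv, Matrix.one_mul]

end Algebra

/-! ## §2  The invariance, `GL_n(F)` -/

section GLn

variable {F : Type*} [Field F] [ValuativeRel F] [TopologicalSpace F] [IsNonarchimedeanLocalField F] {n : ℕ}
  [MeasurableSpace (GL (Fin n) F)] [BorelSpace (GL (Fin n) F)]
  [MeasurableSpace (Matrix (Fin n) (Fin n) F)] [BorelSpace (Matrix (Fin n) (Fin n) F)]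

/-- **The `K × N` orbital functional of `X ∈ 𝔤𝔩_n(F)` with zero off-diagonal entries is `Ad(GL_n(F))`-invariant**:
`∫⁻_{K×N} h((g k n) X (g k n)⁻¹) = ∫⁻_{K×N} h((k n) X (k n)⁻¹)` for every `g ∈ GL_n(F)` and every Borel `h ≥ 0` (the functional is, up to the
Iwasawa constant, the invariant integral `∫⁻_{G ⧸ A} h(y X y⁻¹)`).  [cite: HarishChandra1970, Part V §2 p. 49] [cite: Gelbart1975, Thm. 9.22 (iii)]
[cite: DeitmarEchterhoff2014, Thm. 1.5.3] -/
theorem GLn.lintegral_prod_conj_eq_of_offDiag_eq_zero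
    (κ : Measure ↥(glInt n F)) [IsHaarMeasure κ]
    (μN : Measure ↥(unipotentRadicalGL F (id : Fin n → Fin n))) [IsHaarMeasure μN]
    {X : Matrix (Fin n) (Fin n) F} (hX : ∀ i j, i ≠ j → X i j = 0) (g : GL (Fin n) F)
    {h : Matrix (Fin n) (Fin n) F → ℝ≥0∞} (hh : Measurable h) :
    ∫⁻ q : ↥(glInt n F) × ↥(unipotentRadicalGL F (id : Fin n → Fin n)),
        h (((g * ((q.1 : GL (Fin n) F) * (q.2 : GL (Fin n) F)) : GL (Fin n) F) : Matrix (Fin n) (Fin n) F) * X *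
          (((g * ((q.1 : GL (Fin n) F) * (q.2 : GL (Fin n) F)))⁻¹ : GL (Fin n) F) : Matrix (Fin n) (Fin n) F)) ∂(κ.prod μN) =
      ∫⁻ q : ↥(glInt n F) × ↥(unipotentRadicalGL F (id : Fin n → Fin n)),
        h ((((q.1 : GL (Fin n) F) * (q.2 : GL (Fin n) F) : GL (Fin n) F) : Matrix (Fin n) (Fin n) F) * X *
          ((((q.1 : GL (Fin n) F) * (q.2 : GL (Fin n) F))⁻¹ : GL (Fin n) F) : Matrix (Fin n) (Fin n) F)) ∂(κ.prod μN) := by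
  classical
  -- point-set and measure-theoretic instances
  haveI : T2Space F := (isLocalField F).toT2Space
  haveI : SecondCountableTopology F := secondCountableTopology_localField F
  haveI : LocallyCompactSpace F := (isLocalField F).toLocallyCompactSpace
  haveI : SecondCountableTopology (Matrix (Fin n) (Fin n) F) :=
    inferInstanceAs (SecondCountableTopology (Fin n → Fin n → F))
  haveI : SecondCountableTopology (Matrix (Fin n) (Fin n) F)ᵐᵒᵖ :=
    MulOpposite.opHomeomorph.symm.secondCountableTopology
  haveI : SecondCountableTopology (GL (Fin n) F) :=
    Units.isEmbedding_embedProduct.secondCountableTopology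
  haveI : LocallyCompactSpace (Matrix (Fin n) (Fin n) F) :=
    inferInstanceAs (LocallyCompactSpace (Fin n → Fin n → F))
  haveI : LocallyCompactSpace (GL (Fin n) F) := inferInstance
  haveI : T2Space (GL (Fin n) F) := inferInstance
  haveI : SecondCountableTopology ↥(glInt n F) := TopologicalSpace.Subtype.secondCountableTopology _
  haveI : SecondCountableTopology ↥(unipotentRadicalGL F (id : Fin n → Fin n)) :=
    TopologicalSpace.Subtype.secondCountableTopology _
  haveI : BorelSpace ↥(glInt n F) := Subtype.borelSpace _
  haveI : BorelSpace ↥(unipotentRadicalGL F (id : Fin n → Fin n)) := Subtype.borelSpace _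
  haveI : BorelSpace (↥(glInt n F) × ↥(unipotentRadicalGL F (id : Fin n → Fin n))) := Prod.borelSpace
  -- the diagonal torus `A`, closed and commutative, and an invariant Radon measure on `G ⧸ A`
  set A : Subgroup (GL (Fin n) F) := standardLeviGL F (id : Fin n → Fin n) with hAdef
  have hAc : IsClosed ((A : Subgroup (GL (Fin n) F)) : Set (GL (Fin n) F)) := isClosed_standardLeviGL (R := F) (id : Fin n → Fin n)
  letI : MeasurableSpace (GL (Fin n) F ⧸ A) := borel _
  haveI : BorelSpace (GL (Fin n) F ⧸ A) := ⟨rfl⟩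
  haveI : BorelSpace ↥A := Subtype.borelSpace _
  haveI : LocallyCompactSpace ↥A := hAc.locallyCompactSpace
  haveI : SecondCountableTopology ↥A := TopologicalSpace.Subtype.secondCountableTopology _
  letI : CommGroup ↥A :=
    { (inferInstance : Group ↥A) with
      mul_comm := fun a b => Subtype.ext (mul_comm_of_mem_standardLeviGL_id a.2 b.2) }
  haveI : (haar : Measure (GL (Fin n) F)).IsMulRightInvariant := GLn.isMulRightInvariant_of_isHaarMeasure_local n F _
  haveI : IsTopologicalGroup ↥A := inferInstance
  haveI : (haar : Measure ↥A).Regular := inferInstance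
  haveI : (haar : Measure ↥A).IsInvInvariant := IsHaarMeasure.isInvInvariant_of_regular (haar : Measure ↥A)
  obtain ⟨μ, hμinv, hμreg, hμ0, -⟩ :=
    exists_smulInvariantMeasure_integral_fiberIntegral_eq A (haar : Measure ↥A) hAc (haar : Measure (GL (Fin n) F))
  haveI := hμinv
  haveI := hμreg
  -- Gelbart's Iwasawa form of `μ`
  obtain ⟨C, hC, hμC⟩ := exists_quotientMeasure_torus_eq_smul_map F hAdef μ hμ0 κ μN
  -- the orbit map `Φ : y A ↦ y X y⁻¹`, well defined and continuous
  set Φ : GL (Fin n) F ⧸ A → Matrix (Fin n) (Fin n) F := fun y =>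
    Quotient.liftOn' y (fun y : GL (Fin n) F => (y : Matrix (Fin n) (Fin n) F) * X * ((y⁻¹ : GL (Fin n) F) : Matrix (Fin n) (Fin n) F))
      (fun a b hab => by
        rw [QuotientGroup.leftRel_apply] at hab
        exact conj_eq_conj_of_inv_mul_mem_standardLeviGL_id hab hX) with hΦdef
  have hΦmk : ∀ y : GL (Fin n) F,
      Φ (QuotientGroup.mk y) = (y : Matrix (Fin n) (Fin n) F) * X * ((y⁻¹ : GL (Fin n) F) : Matrix (Fin n) (Fin n) F) := fun _ => rfl
  have hΦc : Continuous Φ := by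
    rw [← QuotientGroup.isOpenQuotientMap_mk.continuous_comp_iff]
    have : Φ ∘ (QuotientGroup.mk : GL (Fin n) F → GL (Fin n) F ⧸ A) =
        fun y : GL (Fin n) F => (y : Matrix (Fin n) (Fin n) F) * X * ((y⁻¹ : GL (Fin n) F) : Matrix (Fin n) (Fin n) F) := rfl
    rw [this]
    exact (Units.continuous_val.mul continuous_const).mul Units.continuous_coe_inv
  have hH : Measurable (h ∘ Φ) := hh.comp hΦc.measurable
  -- the Iwasawa parametrisation `(k, n) ↦ k n A`
  have hπ : Measurable fun q : ↥(glInt n F) × ↥(unipotentRadicalGL F (id : Fin n → Fin n)) =>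
      (QuotientGroup.mk ((q.1 : GL (Fin n) F) * (q.2 : GL (Fin n) F)) : GL (Fin n) F ⧸ A) :=
    ((QuotientGroup.continuous_mk (N := A)).comp ((continuous_subtype_val.comp continuous_fst).mul
      (continuous_subtype_val.comp continuous_snd))).measurable
  -- `∫⁻_{G⧸A} (h ∘ Φ)(g • y) dμ = C • LHS` and `∫⁻_{G⧸A} h ∘ Φ dμ = C • RHS`
  have e1 : ∫⁻ y, (h ∘ Φ) y ∂μ =
      C • ∫⁻ q : ↥(glInt n F) × ↥(unipotentRadicalGL F (id : Fin n → Fin n)),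
        h ((((q.1 : GL (Fin n) F) * (q.2 : GL (Fin n) F) : GL (Fin n) F) : Matrix (Fin n) (Fin n) F) * X *
          ((((q.1 : GL (Fin n) F) * (q.2 : GL (Fin n) F))⁻¹ : GL (Fin n) F) : Matrix (Fin n) (Fin n) F)) ∂(κ.prod μN) := by
    rw [hμC, lintegral_smul_measure, lintegral_map hH hπ]
    rfl
  have e2 : ∫⁻ y, (h ∘ Φ) (g • y) ∂μ =
      C • ∫⁻ q : ↥(glInt n F) × ↥(unipotentRadicalGL F (id : Fin n → Fin n)),
        h (((g * ((q.1 : GL (Fin n) F) * (q.2 : GL (Fin n) F)) : GL (Fin n) F) : Matrix (Fin n) (Fin n) F) * X *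
          (((g * ((q.1 : GL (Fin n) F) * (q.2 : GL (Fin n) F)))⁻¹ : GL (Fin n) F) : Matrix (Fin n) (Fin n) F)) ∂(κ.prod μN) := by
    have hHg : Measurable fun y : GL (Fin n) F ⧸ A => (h ∘ Φ) (g • y) := hH.comp (measurable_const_smul g)
    rw [hμC, lintegral_smul_measure, lintegral_map hHg hπ]
    rfl
  -- invariance of `μ` under `g`
  have e3 : ∫⁻ y, (h ∘ Φ) (g • y) ∂μ = ∫⁻ y, (h ∘ Φ) y ∂μ := by
    calc ∫⁻ y, (h ∘ Φ) (g • y) ∂μ = ∫⁻ y, (h ∘ Φ) y ∂(Measure.map (fun y : GL (Fin n) F ⧸ A => g • y) μ) :=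
          (lintegral_map hH (measurable_const_smul g)).symm
      _ = ∫⁻ y, (h ∘ Φ) y ∂μ := by rw [MeasureTheory.map_smul]
  rw [e1, e2, ENNReal.smul_def, ENNReal.smul_def, smul_eq_mul, smul_eq_mul] at e3
  exact (ENNReal.mul_right_inj (ENNReal.coe_ne_zero.2 hC) ENNReal.coe_ne_top).1 e3

/-- **The `K × N` orbital functional of a diagonal element `diagonal d ∈ 𝔤𝔩_n(F)` is `Ad(GL_n(F))`-invariant** (any `d`, regular or not).
[cite: HarishChandra1970, Part V §2 p. 49] [cite: Gelbart1975, Thm. 9.22 (iii)] -/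
theorem GLn.lintegral_prod_conj_diagonal_eq
    (κ : Measure ↥(glInt n F)) [IsHaarMeasure κ]
    (μN : Measure ↥(unipotentRadicalGL F (id : Fin n → Fin n))) [IsHaarMeasure μN]
    (d : Fin n → F) (g : GL (Fin n) F) {h : Matrix (Fin n) (Fin n) F → ℝ≥0∞} (hh : Measurable h) :
    ∫⁻ q : ↥(glInt n F) × ↥(unipotentRadicalGL F (id : Fin n → Fin n)),
        h (((g * ((q.1 : GL (Fin n) F) * (q.2 : GL (Fin n) F)) : GL (Fin n) F) : Matrix (Fin n) (Fin n) F) * Matrix.diagonal d *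
          (((g * ((q.1 : GL (Fin n) F) * (q.2 : GL (Fin n) F)))⁻¹ : GL (Fin n) F) : Matrix (Fin n) (Fin n) F)) ∂(κ.prod μN) =
      ∫⁻ q : ↥(glInt n F) × ↥(unipotentRadicalGL F (id : Fin n → Fin n)),
        h ((((q.1 : GL (Fin n) F) * (q.2 : GL (Fin n) F) : GL (Fin n) F) : Matrix (Fin n) (Fin n) F) * Matrix.diagonal d *
          ((((q.1 : GL (Fin n) F) * (q.2 : GL (Fin n) F))⁻¹ : GL (Fin n) F) : Matrix (Fin n) (Fin n) F)) ∂(κ.prod μN) :=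
  GLn.lintegral_prod_conj_eq_of_offDiag_eq_zero κ μN (fun _ _ hij => Matrix.diagonal_apply_ne d hij) g hh

end GLn

/-! ## §3  The `N = 3` head (brick D of the (S-B♭)_Lie census, consumed by brick H `K2E3GL3SplitCartanSliceDensity`) -/

section GL3

variable {F : Type*} [Field F] [ValuativeRel F] [TopologicalSpace F] [IsNonarchimedeanLocalField F]
  [MeasurableSpace (GL (Fin 3) F)] [BorelSpace (GL (Fin 3) F)]
  [MeasurableSpace (Matrix (Fin 3) (Fin 3) F)] [BorelSpace (Matrix (Fin 3) (Fin 3) F)]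

/-- **Brick D (N = 3).**  For every `d : Fin 3 → F`, every `g ∈ GL₃(F)` and every Borel `h : 𝔤𝔩₃(F) → [0, ∞]`:
`∫⁻_{K×N₃} h(Ad(g·k·n)(diagonal d)) d(κ ⊗ μN) = ∫⁻_{K×N₃} h(Ad(k·n)(diagonal d)) d(κ ⊗ μN)` (`K = GL₃(𝒪)`, `N₃` upper unitriangular, `κ`, `μN` Haar).
[cite: HarishChandra1970, Part V §2 p. 49] [cite: Rogawski1990, §4.13 p. 69] [cite: Gelbart1975, Thm. 9.22 (iii)] -/
theorem GL3.lintegral_prod_conj_diagonal_eq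
    (κ : Measure ↥(glInt 3 F)) [IsHaarMeasure κ]
    (μN : Measure ↥(unipotentRadicalGL F (id : Fin 3 → Fin 3))) [IsHaarMeasure μN]
    (d : Fin 3 → F) (g : GL (Fin 3) F) (h : Matrix (Fin 3) (Fin 3) F → ℝ≥0∞) (hh : Measurable h) :
    ∫⁻ q : ↥(glInt 3 F) × ↥(unipotentRadicalGL F (id : Fin 3 → Fin 3)),
        h (((g * ((q.1 : GL (Fin 3) F) * (q.2 : GL (Fin 3) F)) : GL (Fin 3) F) : Matrix (Fin 3) (Fin 3) F) * Matrix.diagonal d *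
          (((g * ((q.1 : GL (Fin 3) F) * (q.2 : GL (Fin 3) F)))⁻¹ : GL (Fin 3) F) : Matrix (Fin 3) (Fin 3) F)) ∂(κ.prod μN) =
      ∫⁻ q : ↥(glInt 3 F) × ↥(unipotentRadicalGL F (id : Fin 3 → Fin 3)),
        h ((((q.1 : GL (Fin 3) F) * (q.2 : GL (Fin 3) F) : GL (Fin 3) F) : Matrix (Fin 3) (Fin 3) F) * Matrix.diagonal d *
          ((((q.1 : GL (Fin 3) F) * (q.2 : GL (Fin 3) F))⁻¹ : GL (Fin 3) F) : Matrix (Fin 3) (Fin 3) F)) ∂(κ.prod μN) :=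
  GLn.lintegral_prod_conj_diagonal_eq κ μN d g hh

end GL3

end Summit.HodgeConjecture.HodgeConjecture.Cruxes.H413.K2E3GL3KNOrbitalAdInvariant

end
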